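import Literature.NumberTheory.Automorphic.Sweep1BaseChangeGLOne
import Literature.NumberTheory.Automorphic.ArthurClozelBaseChangeAssembly
import Literature.NumberTheory.Automorphic.ExistsClassFieldCharacterHolds
import HarnessLib

/-!
# Arthur–Clozel, Ch. 3, Thm. 4.2 (a)–(b): the dichotomy in rank `≤ 1`, and its reduction to the
existence clause in rank `≥ 2` (proof file)

Topic `NumberTheory/Automorphic`; namespace `Literature.NumberTheory.Automorphic`. Sibling proof
file (theorems only: no definition, no named fact, no instance) of `Sweep1Proofs` under its named
fact `ArthurClozel1989_exists_cuspidal_weakLift_or_dvd` (Arthur–Clozel, *Simple algebras, base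
change, and the advanced theory of the trace formula*, Ann. of Math. Stud. 120 (1989), Ch. 3,
Thm. 4.2 (a)–(b), rendered as the dichotomy: for `E/F` Galois of prime degree `ℓ` and `π` cuspidal
on `GL_n(𝔸_F)`, **either** `π` has a cuspidal weak base-change lift to `GL_n(𝔸_E)` **or** `ℓ ∣ n`).

The fact quantifies over all ranks `n` (a section variable of `Sweep1Proofs`), so its discharge
`…_holds` needs every `n`. Arthur–Clozel prove Thm. 4.2 by induction on `n` (op. cit. Ch. 3, §4,
beginning of the proof of Thm. 4.2: "We assume all statements of Theorem 4.2 known up to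
`n - 1`"), the inductive step being the comparison (4.1) = (4.2) of the discrete parts of
the trace formulas (Ch. 2, (17.8)), which the tree does not have. This file records what IS
proved and pins the residue to rank `≥ 2`:

* `arthurClozel1989_exists_cuspidal_weakLift_or_dvd_of_dvd`, `…_zero` — the dichotomy is trivial
  when `ℓ ∣ n`, in particular for `n = 0`;
* `arthurClozel1989_exists_cuspidal_weakLift_or_dvd_of_le_one` — **the dichotomy holds outright in
  rank `n ≤ 1`**: rank one is `GL(1)` base change `χ ↦ χ ∘ N_{E/F}`
  (`arthurClozel1989_exists_cuspidal_weakLift_or_dvd_one`, `Sweep1BaseChangeGLOne`), the base of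
  Arthur–Clozel's induction;
* `arthurClozel1989_exists_cuspidal_weakLift_or_dvd_of_two_le` — for a given rank `n` the
  dichotomy reduces to the case `2 ≤ n`, `ℓ ∤ n`;
* `arthurClozel1989_exists_cuspidal_weakLift_or_dvd_of_exists_weakLift_of_twist_ne_of_two_le` —
  **the dichotomy at rank `n` from the existence-and-cuspidality clause of Thm. 4.2 (a) (the
  trace-formula residue, spelled out as the hypothesis `hex` with the binders of
  `ArthurClozel1989_weakLifting_cuspidal`, as in `ArthurClozelBaseChangeAssembly`), class field
  theory (`exists_isClassFieldCharacter`) and multiplicity one over `F` (`multiplicity_one_gl`),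
  each demanded only when `2 ≤ n` and `ℓ ∤ n`** (sharpening
  `arthurClozel1989_exists_cuspidal_weakLift_or_dvd_of_exists_weakLift_of_twist_ne` of
  `ArthurClozelBaseChangeAssembly`, which asks for the three inputs at every rank): when `ℓ ∤ n`
  only the existence half is needed
  (`exists_cuspidal_weakLift_of_exists_weakLift_of_twist_ne_of_not_dvd`: a class-field character
  `η` has order `ℓ ∤ n`, so `π ⊗ η ≠ π` for every cuspidal `π`), and Thm. 4.2 (b) does not enter;
* `arthurClozel1989_exists_cuspidal_weakLift_or_dvd_of_weakLifting_of_two_le` — the same with the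
  named fact `ArthurClozel1989_weakLifting_cuspidal n F E` (Thm. 4.2 (a) as rendered in the tree)
  in place of its clause: **the shape of the eventual discharge of the dichotomy** from
  `exists_isClassFieldCharacter`, `ArthurClozel1989_weakLifting_cuspidal` and `multiplicity_one_gl`
  in ranks `≥ 2` only;
* `exists_cuspidal_baseChange_of_not_dvd_of_weakLifting_of_two_le`,
  `exists_cuspidal_baseChange_of_not_dvd_of_le_one` — the same reduction, and rank `≤ 1`
  outright, for lang.S23 (`exists_cuspidal_baseChange_of_not_dvd`, `Sweep1`), through the proved
  equivalence of `Sweep1BaseChangeProofs`;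
* `arthurClozel1989_exists_cuspidal_weakLift_or_dvd_of_weakLifting_of_multiplicityOne`,
  `exists_cuspidal_baseChange_of_not_dvd_of_weakLifting_of_multiplicityOne` — **the class-field
  input discharged**: with `exists_isClassFieldCharacter_holds` (`ExistsClassFieldCharacterHolds`,
  Tate's Main Theorem (B) for cyclic `E/F`) fed in, and the instance `[FiniteDimensional F E]`
  derived inside from `ℓ = [E : F]` prime, the dichotomy (resp. lang.S23) at rank `n` depends on
  exactly two inputs, each only for `2 ≤ n`, `ℓ ∤ n`: Thm. 4.2 (a)
  (`ArthurClozel1989_weakLifting_cuspidal`, the trace-formula comparison) and multiplicity one for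
  `L²_cusp(GL_n(𝔸_F))` (`multiplicity_one_gl`). The discharge `…_holds` of the dichotomy is this
  theorem applied to the discharges of those two facts, when they exist.

No statement of the tree is modified; no definition or named fact is introduced.

## References

* J. Arthur, L. Clozel, *Simple algebras, base change, and the advanced theory of the trace
  formula*, Ann. of Math. Stud. 120 (1989), Ch. 3, §1 Def. 1.1, Thm. 4.2 (a)–(b) and §4, proof of
  Thm. 4.2 (a) (induction on `n`). [ArthurClozelAMS120]
-/

noncomputable section

namespace Literature.NumberTheory.Automorphic

open NumberField IsDedekindDomain _root_.MeasureTheory Filter AdelicGroupData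

section RankReduction

variable {n : ℕ} {F E : Type} [Field F] [NumberField F] [Field E] [NumberField E] [Algebra F E]

/-- The dichotomy `ArthurClozel1989_exists_cuspidal_weakLift_or_dvd` ("cuspidal weak lift, or
`ℓ ∣ n`") holds trivially at a rank `n` divisible by `ℓ = [E : F]` (right disjunct).
[cite: ArthurClozelAMS120, Ch. 3, Thm. 4.2 (b)] -/
theorem arthurClozel1989_exists_cuspidal_weakLift_or_dvd_of_dvd (h : Module.finrank F E ∣ n) :
    ArthurClozel1989_exists_cuspidal_weakLift_or_dvd (n := n) (F := F) (E := E) :=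
  fun _ _ _ _ => Or.inr h

/-- The dichotomy `ArthurClozel1989_exists_cuspidal_weakLift_or_dvd` in the degenerate rank
`n = 0` (`ℓ ∣ 0`; Arthur–Clozel's `G = GL(n)` has `n ≥ 1`, the tree's rendering quantifies over
all `n`). [cite: ArthurClozelAMS120, Ch. 3, Thm. 4.2 (a)–(b)] -/
theorem arthurClozel1989_exists_cuspidal_weakLift_or_dvd_zero :
    ArthurClozel1989_exists_cuspidal_weakLift_or_dvd (n := 0) (F := F) (E := E) :=
  arthurClozel1989_exists_cuspidal_weakLift_or_dvd_of_dvd (dvd_zero _)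

/-- **Arthur–Clozel, Ch. 3, Thm. 4.2 (a)–(b) (the dichotomy) holds outright in rank `n ≤ 1`**:
`n = 0` is trivial (`arthurClozel1989_exists_cuspidal_weakLift_or_dvd_zero`) and `n = 1` is
`GL(1)` base change `χ ↦ χ ∘ N_{E/F}` (`arthurClozel1989_exists_cuspidal_weakLift_or_dvd_one`,
`Sweep1BaseChangeGLOne`) — the base case of Arthur–Clozel's induction on `n`.
[cite: ArthurClozelAMS120, Ch. 3, Thm. 4.2 (a)–(b) and §4, proof of Thm. 4.2] -/
theorem arthurClozel1989_exists_cuspidal_weakLift_or_dvd_of_le_one (hn : n ≤ 1) :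
    ArthurClozel1989_exists_cuspidal_weakLift_or_dvd (n := n) (F := F) (E := E) := by
  rcases Nat.le_one_iff_eq_zero_or_eq_one.mp hn with rfl | rfl
  · exact arthurClozel1989_exists_cuspidal_weakLift_or_dvd_zero
  · exact arthurClozel1989_exists_cuspidal_weakLift_or_dvd_one

/-- **Reduction of the dichotomy at rank `n` to the case `2 ≤ n`, `ℓ ∤ n`.** If
`ArthurClozel1989_exists_cuspidal_weakLift_or_dvd` holds at rank `n` granted `2 ≤ n` and
`[E : F] ∤ n`, it holds at rank `n`: rank `≤ 1` is
`arthurClozel1989_exists_cuspidal_weakLift_or_dvd_of_le_one`, and `[E : F] ∣ n` is the right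
disjunct. [cite: ArthurClozelAMS120, Ch. 3, Thm. 4.2 (a)–(b)] -/
theorem arthurClozel1989_exists_cuspidal_weakLift_or_dvd_of_two_le
    (h : 2 ≤ n → ¬ Module.finrank F E ∣ n →
      ArthurClozel1989_exists_cuspidal_weakLift_or_dvd (n := n) (F := F) (E := E)) :
    ArthurClozel1989_exists_cuspidal_weakLift_or_dvd (n := n) (F := F) (E := E) := by
  by_cases hd : Module.finrank F E ∣ n
  · exact arthurClozel1989_exists_cuspidal_weakLift_or_dvd_of_dvd hd
  rcases le_or_gt n 1 with hn | hn
  · exact arthurClozel1989_exists_cuspidal_weakLift_or_dvd_of_le_one hn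
  · exact h hn hd

/-- **The dichotomy at rank `n` from the existence clause of Thm. 4.2 (a), class field theory
and multiplicity one over `F`, each needed only when `2 ≤ n` and `ℓ ∤ n`.** For `E/F` Galois of
prime degree `ℓ` and `π` cuspidal on `GL_n(𝔸_F)`: if `ℓ ∣ n` there is nothing to show; if
`n ≤ 1` the dichotomy is the theorem `arthurClozel1989_exists_cuspidal_weakLift_or_dvd_of_le_one`;
otherwise a class-field character `η` (`exists_isClassFieldCharacter`) has order `ℓ ∤ n`, so
`π ⊗ η ≠ π` (`exists_cuspidal_weakLift_of_exists_weakLift_of_twist_ne_of_not_dvd`, using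
multiplicity one over `F` to read `π ≇ π ⊗ η`), and the existence-and-cuspidality clause of
Thm. 4.2 (a) — the hypothesis `hex`, with the binders of `ArthurClozel1989_weakLifting_cuspidal`:
the part of (a) that Arthur–Clozel extract from the comparison of trace formulas — yields a
cuspidal weak lift. Thm. 4.2 (b) and strong multiplicity one over `E` do not enter.
[cite: ArthurClozelAMS120, Ch. 3, Thm. 4.2 (a) and §4, proof of Thm. 4.2 (a)] -/
theorem arthurClozel1989_exists_cuspidal_weakLift_or_dvd_of_exists_weakLift_of_twist_ne_of_two_le
    [FiniteDimensional F E]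
    (hCFT : 2 ≤ n → ¬ Module.finrank F E ∣ n → exists_isClassFieldCharacter (F := F) (E := E))
    (hex : 2 ≤ n → ¬ Module.finrank F E ∣ n →
      ∀ [IsGalois F E] (_hn : 0 < n) (_hℓ : (Module.finrank F E).Prime)
        (η : Literature.NumberTheory.GaloisRepresentations.HeckeCharacter F)
        (hη : η.IsClassFieldCharacter E)
        (μ : Measure (gl n F).automorphicQuotient) [(gl n F).IsAutomorphicMeasure μ]
        (_hm : multiplicity_one_gl n F μ) (P : CuspidalAutomorphicRepGL n F μ)
        (_hP : P.twistByFiniteOrderChar η hη.isFiniteOrder ≠ P),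
        ∃ (ν : Measure (gl n E).automorphicQuotient) (_ : (gl n E).IsAutomorphicMeasure ν)
          (Q : CuspidalAutomorphicRepGL n E ν), IsWeakBaseChangeLift P.1 Q.1)
    (hm : 2 ≤ n → ¬ Module.finrank F E ∣ n →
      ∀ (μ : Measure (gl n F).automorphicQuotient) [(gl n F).IsAutomorphicMeasure μ],
        multiplicity_one_gl n F μ) :
    ArthurClozel1989_exists_cuspidal_weakLift_or_dvd (n := n) (F := F) (E := E) := by
  refine arthurClozel1989_exists_cuspidal_weakLift_or_dvd_of_two_le fun hn hd => ?_
  intro _ hℓ μ _ P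
  exact Or.inl (exists_cuspidal_weakLift_of_exists_weakLift_of_twist_ne_of_not_dvd (hCFT hn hd)
    (hex hn hd) hℓ hd μ (hm hn hd μ) P)

/-- **The shape of the eventual discharge: the dichotomy at rank `n` from Thm. 4.2 (a)
(`ArthurClozel1989_weakLifting_cuspidal`, the named fact), class field theory and multiplicity
one over `F`, each only in rank `2 ≤ n` with `ℓ ∤ n`.** The clause needed by
`arthurClozel1989_exists_cuspidal_weakLift_or_dvd_of_exists_weakLift_of_twist_ne_of_two_le` is the
proved projection `ArthurClozel1989_weakLifting_cuspidal.exists_cuspidal_weakLift` (forget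
`Gal`-invariance of `ν`, `σ`-stability and uniqueness). Rank `≤ 1` being proved, the discharge
of `ArthurClozel1989_exists_cuspidal_weakLift_or_dvd` needs its three first-layer facts in ranks
`≥ 2` only. [cite: ArthurClozelAMS120, Ch. 3, Thm. 4.2 (a)–(b)] -/
theorem arthurClozel1989_exists_cuspidal_weakLift_or_dvd_of_weakLifting_of_two_le
    [FiniteDimensional F E]
    (hCFT : 2 ≤ n → ¬ Module.finrank F E ∣ n → exists_isClassFieldCharacter (F := F) (E := E))
    (ha : 2 ≤ n → ¬ Module.finrank F E ∣ n → ArthurClozel1989_weakLifting_cuspidal n F E)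
    (hm : 2 ≤ n → ¬ Module.finrank F E ∣ n →
      ∀ (μ : Measure (gl n F).automorphicQuotient) [(gl n F).IsAutomorphicMeasure μ],
        multiplicity_one_gl n F μ) :
    ArthurClozel1989_exists_cuspidal_weakLift_or_dvd (n := n) (F := F) (E := E) :=
  arthurClozel1989_exists_cuspidal_weakLift_or_dvd_of_exists_weakLift_of_twist_ne_of_two_le hCFT
    (fun hn hd => ArthurClozel1989_weakLifting_cuspidal.exists_cuspidal_weakLift (ha hn hd)) hm

/-- **lang.S23 at rank `n` from the rank-`≥ 2` inputs.** The Langlands-list statement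
`exists_cuspidal_baseChange_of_not_dvd` (`Sweep1`) at rank `n` follows from Thm. 4.2 (a)
(`ArthurClozel1989_weakLifting_cuspidal`), class field theory and multiplicity one over `F`, each
only for `2 ≤ n`, `ℓ ∤ n`
(`arthurClozel1989_exists_cuspidal_weakLift_or_dvd_of_weakLifting_of_two_le` with
`exists_cuspidal_baseChange_of_not_dvd_of_arthurClozel` of `Sweep1BaseChangeProofs`); in
rank `≤ 1` it is unconditional (`exists_cuspidal_baseChange_of_not_dvd_of_le_one`).
[cite: ArthurClozelAMS120, Ch. 3, Thm. 4.2 (a)] -/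
theorem exists_cuspidal_baseChange_of_not_dvd_of_weakLifting_of_two_le
    [FiniteDimensional F E]
    (hCFT : 2 ≤ n → ¬ Module.finrank F E ∣ n → exists_isClassFieldCharacter (F := F) (E := E))
    (ha : 2 ≤ n → ¬ Module.finrank F E ∣ n → ArthurClozel1989_weakLifting_cuspidal n F E)
    (hm : 2 ≤ n → ¬ Module.finrank F E ∣ n →
      ∀ (μ : Measure (gl n F).automorphicQuotient) [(gl n F).IsAutomorphicMeasure μ],
        multiplicity_one_gl n F μ) :
    exists_cuspidal_baseChange_of_not_dvd (n := n) (F := F) (E := E) :=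
  exists_cuspidal_baseChange_of_not_dvd_of_arthurClozel
    (arthurClozel1989_exists_cuspidal_weakLift_or_dvd_of_weakLifting_of_two_le hCFT ha hm)

/-- **lang.S23 holds outright in rank `n ≤ 1`** (`exists_cuspidal_baseChange_of_not_dvd`, `Sweep1`):
from `arthurClozel1989_exists_cuspidal_weakLift_or_dvd_of_le_one` through
`exists_cuspidal_baseChange_of_not_dvd_of_arthurClozel`.
[cite: ArthurClozelAMS120, Ch. 3, Thm. 4.2 (a)] -/
theorem exists_cuspidal_baseChange_of_not_dvd_of_le_one (hn : n ≤ 1) :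
    exists_cuspidal_baseChange_of_not_dvd (n := n) (F := F) (E := E) :=
  exists_cuspidal_baseChange_of_not_dvd_of_arthurClozel
    (arthurClozel1989_exists_cuspidal_weakLift_or_dvd_of_le_one hn)

/-- **The dichotomy at rank `n` from Thm. 4.2 (a) and multiplicity one over `F` alone, each only
for `2 ≤ n`, `ℓ ∤ n` — the class-field input discharged.** In
`arthurClozel1989_exists_cuspidal_weakLift_or_dvd_of_weakLifting_of_two_le` the class-field
character `η` of `E/F` ("a character of `𝔸^*` vanishing exactly on `F^* N(𝔸_E^*)`", Arthur–Clozel,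
Ch. 3 §4) is now supplied by the tree's discharge `exists_isClassFieldCharacter_holds` of
`exists_isClassFieldCharacter` (Cassels–Fröhlich, Ch. VII (Tate) §5.1 Main Theorem (B), cyclic
case), and the instance `[FiniteDimensional F E]` carried by the renderings of Thm. 4.2 (a) and of
the class-field character is derived from the primality of `ℓ = [E : F]` (`finrank > 0`), so that
the hypotheses have exactly the binders of the named fact. What remains of the discharge of
`ArthurClozel1989_exists_cuspidal_weakLift_or_dvd` is Thm. 4.2 (a) in ranks `n ≥ 2` with `ℓ ∤ n`
(`ArthurClozel1989_weakLifting_cuspidal n F E`: the comparison of trace formulas, op. cit. Ch. 3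
§4 with Ch. 2 (17.8)) and multiplicity one for `L²_cusp(GL_n(𝔸_F))` in ranks `n ≥ 2`
(`multiplicity_one_gl`, Shalika), under which "`π ⊗ η ≠ π`" is the printed `π ≇ π ⊗ η`.
[cite: ArthurClozelAMS120, Ch. 3, Thm. 4.2 (a)–(b) and §4, proof of Thm. 4.2 (a)] -/
theorem arthurClozel1989_exists_cuspidal_weakLift_or_dvd_of_weakLifting_of_multiplicityOne
    (ha : ∀ [FiniteDimensional F E], 2 ≤ n → ¬ Module.finrank F E ∣ n →
      ArthurClozel1989_weakLifting_cuspidal n F E)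
    (hm : 2 ≤ n → ¬ Module.finrank F E ∣ n →
      ∀ (μ : Measure (gl n F).automorphicQuotient) [(gl n F).IsAutomorphicMeasure μ],
        multiplicity_one_gl n F μ) :
    ArthurClozel1989_exists_cuspidal_weakLift_or_dvd (n := n) (F := F) (E := E) := by
  intro _ hℓ μ _ P
  haveI : FiniteDimensional F E := Module.finite_of_finrank_pos hℓ.pos
  exact arthurClozel1989_exists_cuspidal_weakLift_or_dvd_of_weakLifting_of_two_le
    (fun _ _ => exists_isClassFieldCharacter_holds) (fun hn hd => ha hn hd) hm hℓ μ P

/-- **lang.S23 at rank `n` from Thm. 4.2 (a) and multiplicity one over `F` alone, each only for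
`2 ≤ n`, `ℓ ∤ n`** (`exists_cuspidal_baseChange_of_not_dvd`, `Sweep1`): the class-field input of
`exists_cuspidal_baseChange_of_not_dvd_of_weakLifting_of_two_le` discharged by
`exists_isClassFieldCharacter_holds`, through
`arthurClozel1989_exists_cuspidal_weakLift_or_dvd_of_weakLifting_of_multiplicityOne` and
`exists_cuspidal_baseChange_of_not_dvd_of_arthurClozel` (`Sweep1BaseChangeProofs`).
[cite: ArthurClozelAMS120, Ch. 3, Thm. 4.2 (a)] -/
theorem exists_cuspidal_baseChange_of_not_dvd_of_weakLifting_of_multiplicityOne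
    (ha : ∀ [FiniteDimensional F E], 2 ≤ n → ¬ Module.finrank F E ∣ n →
      ArthurClozel1989_weakLifting_cuspidal n F E)
    (hm : 2 ≤ n → ¬ Module.finrank F E ∣ n →
      ∀ (μ : Measure (gl n F).automorphicQuotient) [(gl n F).IsAutomorphicMeasure μ],
        multiplicity_one_gl n F μ) :
    exists_cuspidal_baseChange_of_not_dvd (n := n) (F := F) (E := E) :=
  exists_cuspidal_baseChange_of_not_dvd_of_arthurClozel
    (arthurClozel1989_exists_cuspidal_weakLift_or_dvd_of_weakLifting_of_multiplicityOne ha hm)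

end RankReduction

end Literature.NumberTheory.Automorphic
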